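import Summits.FinalStateConjecture.FinalStateConjecture.Theorems.BartnikGapSettlingBondiBartnikRigidityCompactnessToKerrInteriorDefs
import HarnessLib

/-!
# K3 `stub_compactnessToKerrInterior` — the CHECKED reduction to the four typed facts
# (line `direct-method-on-the-cone`, crux `BondiBartnikRigidity`, stmt-FinalStateConjecture-10807;
# worker K3 of lead c3)

Sorry-free: the semicontinuity bookkeeping of the direct method (`le_of_semicontinuity`,
`bondiBartnikGapLE_zero_of_semicontinuity`: LSC of the cut energy + USC of the infimum + gaps `γₙ → 0`
⇒ the limit core is an exact minimiser, `BondiBartnikGapLE … 0`), the limit of a shadowed sequence as an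
exact minimiser with a competitor (`ExactCollarInstance.exactMinimiser_of_facts`), the soft package
`K3Route.NearMinimiserShadowing` from (F1')–(F4) by contradiction along a failing sequence with
`δₙ = γₙ ≍ 1/(n+1)` (`nearMinimiserShadowing_of_facts`), and the registered K3 from the four facts and
`ExactMinimiserKerrnessOriented` (`stub_compactnessToKerrInterior_of_facts`, the anchor of this file;
its conclusion after the four antecedents is VERBATIM the registered signature).  Statements and audit of
the facts: `…CompactnessToKerrInteriorDefs.lean`.

References: Huang–Lee arXiv:2007.00593, Def. 7.8 (Bartnik's infimum) [HuangLee2020]; Ringström 2009,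
Ch. 16 [RingstromCauchyProblem2009]; Christodoulou–Klainerman 1993, Ch. 17 [ChristodoulouKlainerman1993PMS41].
-/

noncomputable section

-- D-0017: single-problem summit, `Summit.<S>.<S>.…` by design (cf. lakefile `weak.linter.dupNamespace`).
set_option linter.dupNamespace false
-- instance search through the nested operator types of the Kerr chart facts
set_option maxSynthPendingDepth 3

open Set Filter Function Topology TopologicalSpace
open Literature.Geometry.Lorentzian
open scoped Manifold ContDiff Topology ENNReal

namespace Summit.FinalStateConjecture.FinalStateConjecture.Theorems.BondiBartnikRigidity.DirectMethod

namespace K3Route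

/-! ### Semicontinuity bookkeeping of the direct method -/

section Semicontinuity

universe u

/-- **Semicontinuity bookkeeping of the direct method** (abstract form).  Along a sequence with own
energies `ownₙ n`, competitor energies `compₙ n` and gaps `γ n → 0`, if the limit's own energy `m` is
LOWER semicontinuous (eventually every own energy of the approximants is `≥ m − η`) and the limit's
competitor energies are UPPER semicontinuously realised (each is eventually a competitor energy of the
approximants up to `η`), then `m` is below every competitor energy of the limit: the limit is an exact
minimiser.  Pure `ε`-management. [folklore] -/
theorem le_of_semicontinuity {comp : ℝ → Prop} {ownₙ compₙ : ℕ → ℝ → Prop} {γ : ℕ → ℝ}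
    (hγ : Tendsto γ atTop (𝓝 0)) {m : ℝ}
    (lsc : ∀ η : ℝ, 0 < η → ∀ᶠ n in atTop, ∀ m', ownₙ n m' → m ≤ m' + η)
    (usc : ∀ m', comp m' → ∀ η : ℝ, 0 < η → ∀ᶠ n in atTop, ∃ m'', compₙ n m'' ∧ m'' ≤ m' + η)
    (gap : ∀ n m', compₙ n m' → ∀ η : ℝ, 0 < η → ∃ m'', ownₙ n m'' ∧ m'' ≤ m' + γ n + η) :
    ∀ m', comp m' → m ≤ m' := by
  intro m' hm'
  refine le_of_forall_pos_lt_add fun η hη ↦ ?_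
  have hη4 : 0 < η / 4 := by positivity
  have hγ' : ∀ᶠ n in atTop, γ n < η / 4 := hγ.eventually (gt_mem_nhds hη4)
  obtain ⟨n, hn₁, ⟨m₁, hm₁, hm₁le⟩, hn₃⟩ := ((lsc _ hη4).and ((usc m' hm' _ hη4).and hγ')).exists
  obtain ⟨m₂, hm₂, hm₂le⟩ := gap n m₁ hm₁ _ hη4
  have h := hn₁ m₂ hm₂
  linarith

/-- **The limit core is an exact minimiser** (instantiation of `le_of_semicontinuity`): if the cores
`C n` of vacuum Cauchy developments `𝒟 n` have Bondi–Bartnik gaps `≤ γ n → 0`, the limit core `C'`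
of `𝒱` has a cut energy `m` which is lower semicontinuous along the sequence, and every competitor
mass of `C'` is asymptotically realised by competitor masses of the `C n`, then
`BondiBartnikGapLE 𝒱 C' 0` (Bartnik's infimum, Huang–Lee arXiv:2007.00593, Def. 7.8, in the route's
Bondi form: `bondiBartnikGapLE_of_forall_le` with `γ = 0`). [cite: HuangLee2020, Def. 7.8] -/
theorem bondiBartnikGapLE_zero_of_semicontinuity
    {X' : Type u} [TopologicalSpace X'] [ChartedSpace E3 X'] [IsManifold (𝓡 3) ∞ X']
    [ConnectedSpace X'] {D' : InitialDataSet (𝓡 3) X'} {𝒱 : VacuumCauchyDevelopment D'}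
    {C' : Set 𝒱.carrier}
    {X : ℕ → Type u} [∀ n, TopologicalSpace (X n)] [∀ n, ChartedSpace E3 (X n)]
    [∀ n, IsManifold (𝓡 3) ∞ (X n)] [∀ n, ConnectedSpace (X n)]
    {D : ∀ n, InitialDataSet (𝓡 3) (X n)} {𝒟 : ∀ n, VacuumCauchyDevelopment (D n)}
    {C : ∀ n, Set (𝒟 n).carrier} {γ : ℕ → ℝ} (hγ : Tendsto γ atTop (𝓝 0))
    (hgap : ∀ n, (𝒟 n).BondiBartnikGapLE (C n) (γ n))
    {m : ℝ} (hm : 𝒱.toCauchyDevelopment.HasCutBondiMass C' m)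
    (lsc : ∀ η : ℝ, 0 < η → ∀ᶠ n in atTop, ∀ m',
      (𝒟 n).toCauchyDevelopment.HasCutBondiMass (C n) m' → m ≤ m' + η)
    (usc : ∀ m', 𝒱.IsCompetitorMass C' m' → ∀ η : ℝ, 0 < η → ∀ᶠ n in atTop, ∃ m'',
      (𝒟 n).IsCompetitorMass (C n) m'' ∧ m'' ≤ m' + η) :
    𝒱.BondiBartnikGapLE C' 0 :=
  VacuumCauchyDevelopment.bondiBartnikGapLE_of_forall_le hm fun m' hm' ↦ by
    rw [add_zero]
    exact le_of_semicontinuity hγ lsc usc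
      (fun n m'' hm'' η hη ↦ (VacuumCauchyDevelopment.bondiBartnikGapLE_iff.1 (hgap n)) m'' hm'' η hη)
      m' hm'

end Semicontinuity

/-! ### The soft package from the four facts -/

section Facts

/-- **The limit of a shadowed near-minimising sequence is an exact minimiser** once its core has a
cut energy (from (F1')): (F2) gives the lower semicontinuous cut energy `m`, (F3) the upper
semicontinuous realisation of competitor masses, the instances' gaps `γₙ → 0` close
(`bondiBartnikGapLE_zero_of_semicontinuity`); so `L` carries the EXACT thick-collar block
`NearKerrCollarCore k'' 0 0 1 … univ …` of `ExactMinimiserKerrnessOriented`.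
[cite: HuangLee2020, Def. 7.8] -/
theorem ExactCollarInstance.exactMinimiser_of_facts (hF2 : CutEnergyLSC)
    (hF3 : CompetitorRealisation) {χ m₀ : ℝ} {k' : ℕ} {Λ : ℝ≥0∞} {δ : ℕ → ℝ≥0∞} {γ : ℕ → ℝ}
    (hδ : Tendsto δ atTop (𝓝 0)) (hγ : Tendsto γ atTop (𝓝 0))
    (I : ∀ n, NearMinimisingInstance χ m₀ k' Λ (δ n) (γ n)) {k'' k : ℕ}
    (L : ExactCollarInstance k'') (sh : Shadow I L k) (hk : 2 ≤ k)
    (hmass : ∃ m : ℝ, L.𝒱.toCauchyDevelopment.HasCutBondiMass L.core m) :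
    L.𝒱.NearKerrCollarCore k'' 0 0 1 L.M L.a univ L.p L.mo L.B L.Φ := by
  obtain ⟨m, hm, lsc⟩ := hF2 χ m₀ k' Λ δ γ hδ hγ I k'' k L sh hk hmass
  have usc := hF3 χ m₀ k' Λ δ γ hδ hγ I k'' k L sh hk
  refine L.nearKerrCollarCore ⟨m, hm⟩ ?_
  exact bondiBartnikGapLE_zero_of_semicontinuity (X := fun n ↦ (I (sh.cv.sub n)).X)
    (𝒟 := fun n ↦ (I (sh.cv.sub n)).𝒟) (C := fun n ↦ (I (sh.cv.sub n)).core)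
    (hγ.comp sh.cv.strictMono_sub.tendsto_atTop) (fun n ↦ (I (sh.cv.sub n)).bondiBartnikGapLE)
    hm lsc usc

/-- **The soft package from the four facts** (pure logic: contradiction along a failing sequence with
`δₙ = γₙ ≍ 1/(n+1)`).  Fix `(χ, m₀, k₁, ε₁, R, T)`; (F1') at order `k = k₁ + 2` names `k'`; if for
some `Λ < 1` no `(δ, γ)` worked, choose for each `n` an unshadowed instance at `δₙ = γₙ`; (F1') gives
a limit exact-collar instance shadowing a subsequence, with a cut energy and a competitor mass,
(F2)/(F3) make it an exact minimiser (`exactMinimiser_of_facts`); if it has exact boxes of every size,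
(F4) transfers one to a late member of the subsequence, which is then shadowed — contradiction; if
not, every member is shadowed vacuously — contradiction. [folklore] -/
theorem nearMinimiserShadowing_of_facts (hF1 : LeafCompactness') (hF2 : CutEnergyLSC)
    (hF3 : CompetitorRealisation) (hF4 : BoxTransfer) : NearMinimiserShadowing := by
  intro χ m₀ k₁ ε₁ R T hχ hm₀ hε₁
  obtain ⟨k', hk'⟩ := hF1 χ m₀ (k₁ + 2) hχ hm₀
  refine ⟨k', fun Λ hΛ ↦ ?_⟩
  by_contra hcon
  -- the failing sequence
  set δ : ℕ → ℝ≥0∞ := fun n ↦ ((n + 1 : ℕ) : ℝ≥0∞)⁻¹ with hδdef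
  set γ : ℕ → ℝ := fun n ↦ 1 / ((n : ℝ) + 1) with hγdef
  have hδpos : ∀ n, 0 < δ n := fun n ↦ ENNReal.inv_pos.2 (ENNReal.natCast_ne_top _)
  have hδ : Tendsto δ atTop (𝓝 0) := ENNReal.tendsto_inv_nat_nhds_zero.comp (tendsto_add_atTop_nat 1)
  have hγpos : ∀ n, 0 < γ n := fun n ↦ by rw [hγdef]; positivity
  have hγ : Tendsto γ atTop (𝓝 0) := tendsto_one_div_add_atTop_nhds_zero_nat
  have hbad : ∀ n, ∃ I : NearMinimisingInstance χ m₀ k' Λ (δ n) (γ n), ¬ I.IsShadowed k₁ ε₁ R T :=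
    fun n ↦ not_forall.1 fun h ↦ hcon ⟨δ n, γ n, hδpos n, hγpos n, h⟩
  choose I hI using hbad
  -- its limit, an exact minimiser with a competitor
  obtain ⟨L, ⟨sh⟩, hmass, hcomp'⟩ := hk' Λ hΛ δ γ hδpos hδ hγpos hγ I
  have hcore' := L.exactMinimiser_of_facts hF2 hF3 hδ hγ I sh (by omega) hmass
  by_cases hbox : ∀ (K : ℕ) (R' T' : ℝ), ∃ (τ' : ℝ) (Ψ' : (L.B 0).domain → L.𝒱.carrier),
      IsNearModelBox L.𝒱.toSpacetime (L.B 0) K 0 τ' (τ' + T') (L.M 0) (R' + 1)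
        (L.𝒱.metric.causalFuture L.𝒱.timeOrientation L.core) Ψ'
  · obtain ⟨n, hn⟩ :=
      (hF4 χ m₀ k' Λ δ γ hδ hγ I (k₁ + 2 + 2) (k₁ + 2) L sh k₁ ε₁ R T (by omega) hε₁ hbox).exists
    exact hI (sh.cv.sub n) ⟨k₁ + 2 + 2, by omega, L, hcore', hcomp', fun _ ↦ hn⟩
  · exact hI (sh.cv.sub 0) ⟨k₁ + 2 + 2, by omega, L, hcore', hcomp', fun h ↦ (hbox h).elim⟩

end Facts

end K3Route

/-! ### The registered K3 from the four facts and `ExactMinimiserKerrnessOriented` -/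

/-- **K3 from the four typed facts and exact-minimiser Kerrness** (the anchor of this file,
registered as `stub_compactnessToKerrInterior_of_facts`): the honest route of the line, sorry-free
modulo its antecedents (F1') `K3Route.LeafCompactness'`, (F2) `K3Route.CutEnergyLSC`, (F3)
`K3Route.CompetitorRealisation`, (F4) `K3Route.BoxTransfer` — through
`K3Route.nearMinimiserShadowing_of_facts` and `stub_compactnessToKerrInterior_of_shadowing`; the
conclusion after the four antecedents is VERBATIM the registered signature of
`stub_compactnessToKerrInterior` (whose own antecedent `ExactMinimiserKerrnessOriented` is K1 ∘ K2).
[folklore] -/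
theorem stub_compactnessToKerrInterior_of_facts : K3Route.LeafCompactness' → K3Route.CutEnergyLSC → K3Route.CompetitorRealisation → K3Route.BoxTransfer → ExactMinimiserKerrnessOriented → ∀ (χ m₀ : ℝ) (k₁ : ℕ) (ε₁ : ℝ≥0∞) (R T : ℝ), χ < 1 → 0 < m₀ → 0 < ε₁ → ∃ k' : ℕ, ∀ Λ : ℝ≥0∞, Λ < 1 → ∃ (δ : ℝ≥0∞) (γ : ℝ), 0 < δ ∧ 0 < γ ∧ ∀ (X : Type) [TopologicalSpace X] [ChartedSpace E3 X] [IsManifold (𝓡 3) ∞ X] [T2Space X] [SecondCountableTopology X] [ConnectedSpace X], ∀ D ∈ admissibleVacuumData X, ∀ (𝒟 : VacuumCauchyDevelopment D) (M a : Fin 1 → ℝ) (S : Set 𝒟.carrier) (p : 𝒟.carrier) (mo : Fin 1 → lorentzGroup × E4) (B : Fin 1 → ModelBackground) (Φ : ∀ i, (B i).domain → 𝒟.carrier), 𝒟.IsMaximal → (∀ i, m₀ ≤ M i ∧ M i ≤ m₀⁻¹ ∧ |a i| ≤ χ * M i) → IsPinnedSoundNearKerrLeaf 𝒟.toCauchyDevelopment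 k' Λ 1 M a S → p ∈ S → (∃ i, p ∈ Φ i '' (B i).truncTimeSlab (3 * M i) 0) → (mo 0).1 = 1 → 𝒟.NearKerrCollarCore k' δ γ 1 M a S p mo B Φ → K2Route.CollarFutureOriented 𝒟 M mo B Φ → K2Route.CollarTimeOriented 𝒟 M a mo B Φ → ∃ (τ : ℝ) (Ψ : (B 0).domain → 𝒟.carrier), IsNearModelBox 𝒟.toSpacetime (B 0) k₁ ε₁ τ (τ + T) (M 0) (R + 1) (𝒟.metric.causalFuture 𝒟.timeOrientation (collarCore M p B Φ)) Ψ :=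
  fun hF1 hF2 hF3 hF4 ↦ stub_compactnessToKerrInterior_of_shadowing
    (K3Route.nearMinimiserShadowing_of_facts hF1 hF2 hF3 hF4)

end Summit.FinalStateConjecture.FinalStateConjecture.Theorems.BondiBartnikRigidity.DirectMethod

end
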